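import Summits.CriticalPhenomena.PercolationContinuityZ3.Theorems.FK.PressureFieldDerivative
import Mathlib.MeasureTheory.Integral.IntervalIntegral.FundThmCalculus
import HarnessLib

/-!
# THE PRESSURE IS THE INTEGRAL OF THE MAGNETISATION: `ψ(β,b) − ψ(β,a) = ∫_a^b β m(β,t) dt` (`0 ≤ a ≤ b`)
# and `β m*(β) |h| ≤ ψ(β,h) − ψ(β,0) ≤ β m(β,|h|) |h|` (Friedli–Velenik 2017, §3.2.3 eq. (3.9), Prop. 3.29, Thm. 3.43)

Claimed R42 (8)(c) in the cell INBOX at 2026-08-28T23:16:28Z by fkp-10a gen 356 (NEW CLAIM #3 of the gen), addressed to coordinator fk-4 gen 283 (seated 21:31Z 2026-08-28 by l.8554; R157 / R158 in force); lineage row FO-10a-g356s (self-suggested), package g356-sumrules, label SR-B.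
Helper file of the `fk-continuity` build cell (bschramm lane; `--supports stmt-CriticalPhenomena-4575`); builds on
p205010 (kernel theorem, internal audit signed; external expert review pending). No definitions, no named facts, no
sorries; standard axioms. UNCONDITIONAL (nearest-neighbour Ising model on `ℤ^d`, `d ≥ 1`).

The integrated form of `PressureFieldDerivative` (`∂ψ/∂h = β m(β,h)` on `(0,∞)`, `ψ(β,·)` continuous and even):

* `intervalIntegrable_magnetizationInField` — `m(β,·)` (nondecreasing on `[0,∞)`) is integrable on `[a,b] ⊂ [0,∞)`;
* **`integral_mul_magnetizationInField_eq`** — `∫_a^b β m(β,t) dt = ψ(β,b) − ψ(β,a)` for `0 ≤ a ≤ b` (the endpoint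
  `a = 0` included: only the derivative on the open interval is needed); `pressure_eq_pressure_zero_add_integral` —
  `ψ(β,h) = ψ(β,0) + ∫_0^h β m(β,t) dt` (`h ≥ 0`);
* `mul_spontaneousMagnetization_mul_le_pressure_sub` / `pressure_sub_le_mul_magnetizationInField_mul` —
  **`β m*(β) h ≤ ψ(β,h) − ψ(β,0) ≤ β m(β,h) h`** for `h ≥ 0` (`m*(β) ≤ m(β,t) ≤ m(β,h)` on `[0,h]`);
  `mul_spontaneousMagnetization_mul_abs_le_pressure_sub` — `β m*(β) |h| ≤ ψ(β,h) − ψ(β,0)` for every real `h`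
  (evenness): the pressure has a CORNER of opening `2β m*(β)` at `h = 0` exactly when `m*(β) > 0`.

## References

* S. Friedli, Y. Velenik, *Statistical Mechanics of Lattice Systems*, CUP (2017), §3.2.3 eq. (3.9), Prop. 3.29,
  Thm. 3.34, Thm. 3.43. [FriedliVelenik2017]
* R. S. Ellis, *Entropy, Large Deviations, and Statistical Mechanics*, Springer (1985/2006), Thm. V.4.3. [Ellis2006]
-/

noncomputable section

namespace Summit.CriticalPhenomena.PercolationContinuityZ3.Theorems.FK

namespace IsingSusceptibility

open MeasureTheory Filter Topology Finset Set intervalIntegral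
open Literature.Probability.LatticeModels

variable {d : ℕ}

/-- `m(β,·)` is integrable on every `[a,b]` with `0 ≤ a, b` (it is nondecreasing on `[0,∞)`). [cite: FriedliVelenik2017, Lemma 3.31 (1)] -/
theorem intervalIntegrable_magnetizationInField {β a b : ℝ} (hβ : 0 ≤ β) (ha : 0 ≤ a) (hb : 0 ≤ b) :
    IntervalIntegrable (fun t => magnetizationInField d β t) volume a b := by
  refine ((monotoneOn_magnetizationInField (d := d) hβ).mono fun t ht => ?_).intervalIntegrable
  rcases le_total a b with hab | hab
  · rw [uIcc_of_le hab] at ht; exact mem_Ici.2 (ha.trans ht.1)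
  · rw [uIcc_of_ge hab] at ht; exact mem_Ici.2 (hb.trans ht.1)

/-- **THE PRESSURE IS THE INTEGRAL OF THE MAGNETISATION**: for `d ≥ 1`, `β ≥ 0` and `0 ≤ a ≤ b`,
`∫_a^b β m(β,t) dt = ψ(β,b) − ψ(β,a)` (fundamental theorem of calculus with `∂ψ/∂h = β m` on the open interval and
the continuity of `ψ(β,·)`). [cite: FriedliVelenik2017, §3.2.3 eq. (3.9) and Thm. 3.43] -/
theorem integral_mul_magnetizationInField_eq (hd : 1 ≤ d) {β a b : ℝ} (hβ : 0 ≤ β) (ha : 0 ≤ a) (hab : a ≤ b) :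
    ∫ t in a..b, β * magnetizationInField d β t = pressure d β b - pressure d β a :=
  integral_eq_sub_of_hasDerivAt_of_le hab (continuous_pressure_field (d := d) β).continuousOn
    (fun _ ht => hasDerivAt_pressure_field hd hβ (ha.trans_lt ht.1))
    ((intervalIntegrable_magnetizationInField hβ ha (ha.trans hab)).const_mul β)

/-- **`ψ(β,h) = ψ(β,0) + ∫_0^h β m(β,t) dt`** for `h ≥ 0`. [cite: FriedliVelenik2017, §3.2.3 eq. (3.9)] -/
theorem pressure_eq_pressure_zero_add_integral (hd : 1 ≤ d) {β h : ℝ} (hβ : 0 ≤ β) (hh : 0 ≤ h) :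
    pressure d β h = pressure d β 0 + ∫ t in (0 : ℝ)..h, β * magnetizationInField d β t := by
  rw [integral_mul_magnetizationInField_eq hd hβ le_rfl hh]; ring

/-- **Lower bound `β m*(β) h ≤ ψ(β,h) − ψ(β,0)`** for `h ≥ 0` (`m(β,t) ≥ m*(β)` on `[0,h]`).
[cite: FriedliVelenik2017, Prop. 3.29 and Thm. 3.34] -/
theorem mul_spontaneousMagnetization_mul_le_pressure_sub (hd : 1 ≤ d) {β h : ℝ} (hβ : 0 ≤ β) (hh : 0 ≤ h) :
    β * spontaneousMagnetization d β * h ≤ pressure d β h - pressure d β 0 := by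
  rw [← integral_mul_magnetizationInField_eq hd hβ le_rfl hh]
  have hconst : ∫ _ in (0 : ℝ)..h, β * spontaneousMagnetization d β = β * spontaneousMagnetization d β * h := by
    rw [intervalIntegral.integral_const]; simp [mul_comm]
  rw [← hconst]
  refine intervalIntegral.integral_mono_on hh intervalIntegrable_const
    ((intervalIntegrable_magnetizationInField hβ le_rfl hh).const_mul β) fun t ht => ?_
  refine mul_le_mul_of_nonneg_left ?_ hβ
  rw [← magnetizationInField_zero]
  exact monotoneOn_magnetizationInField (d := d) hβ (mem_Ici.2 le_rfl) (mem_Ici.2 ht.1) ht.1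

/-- **Upper bound `ψ(β,h) − ψ(β,0) ≤ β m(β,h) h`** for `h ≥ 0` (`m(β,t) ≤ m(β,h)` on `[0,h]`).
[cite: FriedliVelenik2017, Thm. 3.43] -/
theorem pressure_sub_le_mul_magnetizationInField_mul (hd : 1 ≤ d) {β h : ℝ} (hβ : 0 ≤ β) (hh : 0 ≤ h) :
    pressure d β h - pressure d β 0 ≤ β * magnetizationInField d β h * h := by
  rw [← integral_mul_magnetizationInField_eq hd hβ le_rfl hh]
  have hconst : ∫ _ in (0 : ℝ)..h, β * magnetizationInField d β h = β * magnetizationInField d β h * h := by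
    rw [intervalIntegral.integral_const]; simp [mul_comm]
  rw [← hconst]
  refine intervalIntegral.integral_mono_on hh ((intervalIntegrable_magnetizationInField hβ le_rfl hh).const_mul β)
    intervalIntegrable_const fun t ht => ?_
  exact mul_le_mul_of_nonneg_left (monotoneOn_magnetizationInField (d := d) hβ (mem_Ici.2 ht.1) (mem_Ici.2 hh) ht.2) hβ

/-- **The corner at `h = 0`: `β m*(β) |h| ≤ ψ(β,h) − ψ(β,0)` for every real `h`** (evenness `ψ(β,−h) = ψ(β,h)`): the
pressure lies above the cone of opening `2β m*(β)` at the symmetry point. [cite: FriedliVelenik2017, Thm. 3.34 and §3.7.1] -/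
theorem mul_spontaneousMagnetization_mul_abs_le_pressure_sub (hd : 1 ≤ d) {β : ℝ} (hβ : 0 ≤ β) (h : ℝ) :
    β * spontaneousMagnetization d β * |h| ≤ pressure d β h - pressure d β 0 := by
  rcases le_total 0 h with hh | hh
  · rw [abs_of_nonneg hh]
    exact mul_spontaneousMagnetization_mul_le_pressure_sub hd hβ hh
  · rw [abs_of_nonpos hh, ← pressure_neg_field (d := d) β h]
    exact mul_spontaneousMagnetization_mul_le_pressure_sub hd hβ (neg_nonneg.2 hh)

end IsingSusceptibility

end Summit.CriticalPhenomena.PercolationContinuityZ3.Theorems.FK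

end
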